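import Summits.BirchSwinnertonDyer.BirchSwinnertonDyer.Theses.BiquadraticEisensteinDescent
import Summits.BirchSwinnertonDyer.Rank1Residual.X11b.RouteR1IntReceptacle
import HarnessLib

/-!
# Route `BiquadraticEisensteinDescent` (W-ALL row 12 · K12i): the deciding theorem GOES THROUGH in ♭-currency —
# with the links (E_adm)/(W_adm) read over the wide receptacle `𝓞_{ℂ_p}⟦T⟧` (`X11b.R1.IsBDPLFunctionInt`,
# `IntSeries.HasValueAt`, containment along `X11b.R1.toCpInt`) instead of Castella's `R₀⟦T⟧`

Helper for crux item stmt-BirchSwinnertonDyer-20195 `KatzWaldspurgerFrameCMInertBadAdm` (W_adm; successor of the retired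
stmt-…-20240), prover seat bsd-wall-bed-p2 g0, 2026-08-27. HONEST FRAMING: nothing here closes W_adm or any item; no
definition, no named fact, no `sorry`. This file is the kernel-checked form of the prover's finding (memo
`W-DIAGNOSIS.md`, evidence #3 on 20195): the `R₀`-rationality demanded by (W)/(E) as filed — `L ∈ R₀⟦T⟧`, `Ω_p ∈ R₀ˣ`
(Castella 2018 Thm. 3.1's receptacle, printed for square-free `N` only; at `p² ∣ N` the `R₀`-DESCENT of the any-level
object is not in print) — is NOT LOAD-BEARING for the route: the deciding theorem `closes` (rev 6) uses of the frame only
`‖[T⁰]G‖ ≤ 1` for the cofactor of `f_ac` in `(L)` and `‖u‖ = 1` for the unit of the value at `𝟙`, and both hold over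
`𝓞_{ℂ_p}` (`X11b.R1.norm_coe_padicComplexInt_le_one`). Consequently the route can be restated with

* (E♭_adm) — `EisensteinDivisibilityCMInertBadAdm` with the frame `(Ω_K′, Ω_p, L ∈ R₀⟦T⟧)`, `IsBDPLFunction`, `toUnr`
  replaced by `(Ω_K′, Ω_p, Q ∈ 𝓞_{ℂ_p}⟦T⟧)`, `X11b.R1.IsBDPLFunctionInt`, `X11b.R1.toCpInt` (binders otherwise VERBATIM);
* (W♭_adm) — `KatzWaldspurgerFrameCMInertBadAdm` with the same replacement and the value clause
  `∃ u : ℂ_p, ‖u‖ = 1 ∧ IntSeries.HasValueAt Q 0 (u · (log_ω P)²)` (binders otherwise VERBATIM),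

and this file PROVES:

* `two_mul_valuation_le_int` — the algebra of halves in the ADDITIVE normalisation over `𝓞_{ℂ_p}⟦T⟧` (sharp, no `−1`:
  `f ∈ Λ`, `f(0) ≠ 0`, `f·𝓞_{ℂ_p}⟦T⟧ ∈ (Q)`, `Q(0) = u·x²` with `‖u‖ ≤ 1` ⟹ `x ≠ 0 ∧ 2·ord_p x ≤ ord_p f(0)`; the
  multiplicative sibling with the Euler factor `(1 − a p⁻¹)` and the lossy `−1` is `X11b.R1.two_mul_sub_one_le_valuation_int`);
* `flatW_of_W` — (W_adm) ⟹ (W♭_adm) (an `R₀`-frame read in `𝓞_{ℂ_p}⟦T⟧`: `X11b.R1.isBDPLFunctionInt_map`,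
  `X11b.R1.intSeries_hasValueAt_map_iff`), i.e. the ♭-form of W is WEAKER than W as filed; its existence conjuncts are the
  theorem `…KatzWaldspurgerFrameCMInertBadFromPrint.exists_frameInt_of_thmA_anyLevel` (p508877; conditional on the
  published fact `Hsieh2014.thmA_exists_isHsiehLFunction_unrPeriod_anyLevel` only), so in ♭-currency only the VALUE AT `𝟙`
  remains a crux. (E♭_adm) quantifies over MORE frames than (E_adm) (every ♭-frame, not only the `R₀`-rational ones);
  the two agree granted frame rigidity across periods — in the tree at FIXED periods: `X11b.R1.isBDPLFunctionInt_unique`);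
* `wallCornerFInertBad_of_flat` — **(E♭_adm) → (W♭_adm) → (C_adm) → R₃ → R₅₇ → PUB → KS → `WAllCornerFInertBad`**: the
  rev-6 deciding theorem `closes` VERBATIM (strong curve, Manin datum, one admissible Heegner field from KS, the one-datum
  lemma `X12.bsdp_of_classX12_of_not_cmRamified_of_indexLowerBoundAt`, Cassels), with its step `key` replaced by
  `two_mul_valuation_le_int`. CONDITIONAL on all seven binders exactly like `closes`; nothing booked.

References: [Castella2018] Camb. J. Math. 6 (2018), Thms. 3.1–3.2 (arXiv:1704.06608 p. 9); [Hsieh2014] Doc. Math. 19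
(2014), Thm. A and p. 7 (the receptacle `Z̄_p⟦Γ⁻⟧ ⊆ 𝓞_{ℂ_p}⟦T⟧`); [JetchevSkinnerWan2017] §7.4.1 (the algebra of halves).

File with: `ledger propose --kind proof --target
  Summits/BirchSwinnertonDyer/BirchSwinnertonDyer/Theorems/BiquadraticEisensteinDescentKatzWaldspurgerFrameCMInertBadFlatGlue.lean
  --file work/FlatGlue.lean --supports stmt-BirchSwinnertonDyer-20195 --as helper`.
-/

set_option autoImplicit false

-- D-0017 layout: summit = sub-problem, so `Summit.BirchSwinnertonDyer.BirchSwinnertonDyer.…` is the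
-- mandated namespace of Theorems files (same option as the route's sibling Theorems files).
set_option linter.dupNamespace false

noncomputable section

open scoped Classical

namespace Summit.BirchSwinnertonDyer.BirchSwinnertonDyer.Theorems.BiquadraticEisensteinDescentKatzWaldspurgerFrameCMInertBadFlatGlue

open WeierstrassCurve NumberField IsDedekindDomain Field PowerSeries
  Literature.NumberTheory.EllipticCurves Literature.NumberTheory.EllipticCurves.ModularForms
  Literature.NumberTheory.EllipticCurves.Rank1Residual
  Summit.BirchSwinnertonDyer.Rank1Residual Summit.BirchSwinnertonDyer.Rank1Residual.X11b
  Summit.BirchSwinnertonDyer.Rank1Residual.X11b.AcSelmer Summit.BirchSwinnertonDyer.Rank1Residual.X11b.Halves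
  Summit.BirchSwinnertonDyer.Rank1Residual.X11b.CongruenceLimit
  Summit.BirchSwinnertonDyer.BirchSwinnertonDyer.Theses.BiquadraticEisensteinDescent

/-! ### §1 The algebra of halves over `𝓞_{ℂ_p}⟦T⟧` in the additive normalisation (sharp) -/

/-- **Halves over the wide receptacle, additive normalisation.** If `f ∈ Λ = ℤ_p⟦T⟧` has non-zero constant term, its
image in `𝓞_{ℂ_p}⟦T⟧` lies in `(Q)`, and `Q(0) = u·x²` with `‖u‖ ≤ 1`, then `x ≠ 0` and `2·ord_p x ≤ ord_p f(0)`
(norms in `ℂ_p`: `‖f(0)‖ = ‖G(0)‖·‖Q(0)‖ ≤ ‖Q(0)‖ ≤ ‖x‖²`). The step `key` of the route's `closes`, with `R₀` widened to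
`𝓞_{ℂ_p}` and the unit relaxed to `‖u‖ ≤ 1`. [cite: JetchevSkinnerWan2017, §7.4.1 (arXiv:1512.06894 p. 30) (shape of the argument)] -/
theorem two_mul_valuation_le_int {p : ℕ} [Fact p.Prime] {f : IwasawaAlgebra p}
    (hf0 : PowerSeries.constantCoeff f ≠ 0) {Q : PowerSeries (PadicComplexInt p)}
    (hfQ : PowerSeries.map (R1.toCpInt p) f ∈ Ideal.span {Q}) {u : ℂ_[p]} (hu : ‖u‖ ≤ 1) {x : ℚ_[p]}
    (hQ : IntSeries.HasValueAt Q 0 (u * (algebraMap ℚ_[p] ℂ_[p] x) ^ 2)) :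
    x ≠ 0 ∧ 2 * x.valuation ≤ ((PowerSeries.constantCoeff f).valuation : ℤ) := by
  have hp : p.Prime := Fact.out
  have hQ0 : u * (algebraMap ℚ_[p] ℂ_[p] x) ^ 2 =
      ((PowerSeries.constantCoeff Q : PadicComplexInt p) : ℂ_[p]) :=
    R1.intSeries_eq_constantCoeff_of_hasValueAt_zero p hQ
  obtain ⟨G, hG⟩ := Ideal.mem_span_singleton'.mp hfQ
  have hfac : algebraMap ℚ_[p] ℂ_[p] ((PowerSeries.constantCoeff f : ℤ_[p]) : ℚ_[p]) =
      ((PowerSeries.constantCoeff G : PadicComplexInt p) : ℂ_[p]) *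
        ((PowerSeries.constantCoeff Q : PadicComplexInt p) : ℂ_[p]) := by
    rw [← R1.coe_toCpInt, ← constantCoeff_map_apply (R1.toCpInt p) f, ← hG, map_mul, MulMemClass.coe_mul]
  have hp1 : (1 : ℝ) < p := by exact_mod_cast hp.one_lt
  have hnormf : ‖((PowerSeries.constantCoeff f : ℤ_[p]) : ℚ_[p])‖ ≤ ‖x‖ ^ 2 := by
    calc ‖((PowerSeries.constantCoeff f : ℤ_[p]) : ℚ_[p])‖
        = ‖algebraMap ℚ_[p] ℂ_[p] ((PowerSeries.constantCoeff f : ℤ_[p]) : ℚ_[p])‖ :=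
          (norm_algebraMap' ℂ_[p] _).symm
      _ = ‖((PowerSeries.constantCoeff G : PadicComplexInt p) : ℂ_[p])‖ *
            ‖((PowerSeries.constantCoeff Q : PadicComplexInt p) : ℂ_[p])‖ := by rw [hfac, norm_mul]
      _ ≤ 1 * ‖((PowerSeries.constantCoeff Q : PadicComplexInt p) : ℂ_[p])‖ :=
          mul_le_mul_of_nonneg_right (R1.norm_coe_padicComplexInt_le_one p _) (norm_nonneg _)
      _ = ‖u‖ * ‖algebraMap ℚ_[p] ℂ_[p] x‖ ^ 2 := by rw [one_mul, ← hQ0, norm_mul, norm_pow]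
      _ ≤ 1 * ‖algebraMap ℚ_[p] ℂ_[p] x‖ ^ 2 :=
          mul_le_mul_of_nonneg_right hu (pow_nonneg (norm_nonneg _) 2)
      _ = ‖x‖ ^ 2 := by rw [one_mul, norm_algebraMap']
  have hx0 : x ≠ 0 := by
    intro hx
    rw [hx, norm_zero, zero_pow two_ne_zero] at hnormf
    exact hf0 (PadicInt.coe_eq_zero.mp (norm_eq_zero.mp (le_antisymm hnormf (norm_nonneg _))))
  refine ⟨hx0, ?_⟩
  rw [← PadicInt.norm_def, PadicInt.norm_eq_zpow_neg_valuation hf0,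
    Padic.norm_eq_zpow_neg_valuation hx0] at hnormf
  have hrhs : ((p : ℝ) ^ (-x.valuation)) ^ 2 = (p : ℝ) ^ (- (2 * x.valuation)) := by
    rw [← zpow_natCast ((p : ℝ) ^ (-x.valuation)) 2, ← zpow_mul]
    congr 1
    push_cast
    ring
  rw [hrhs, zpow_le_zpow_iff_right₀ hp1] at hnormf
  omega

/-! ### §2 (W_adm) ⟹ (W♭_adm): the ♭-form is weaker -/

/-- **(W_adm) as filed implies its ♭-form**: an `R₀`-frame `(Ω_K′, Ω_p, L)` with `IsBDPLFunction` and value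
`u·(log_ω P)²`, `u ∈ R₀ˣ`, read in `𝓞_{ℂ_p}⟦T⟧` along `R₀ ⊆ 𝓞_{ℂ_p}`, is a ♭-frame with `X11b.R1.IsBDPLFunctionInt` and
the same value with `‖u‖ = 1`. So restating W in ♭-currency WEAKENS the item. [cite: Castella2018, Thm. 3.1 and Thm. 3.2 (arXiv:1704.06608 p. 9) (shape)] -/
theorem flatW_of_W (h : KatzWaldspurgerFrameCMInertBadAdm) :
      ∀ (W : WeierstrassCurve ℚ) [W.IsElliptic] [W.IsGloballyMinimal] (p : ℕ) [Fact p.Prime] [NeZero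
      (W.conductorNorm ℤ)] (K : Type) [Field K] [NumberField K] (Dt :
      Literature.NumberTheory.EllipticCurves.ModularForms.ModularParametrizationData W (W.conductorNorm ℤ)) (H
      : Literature.NumberTheory.EllipticCurves.HeegnerDatum (W.conductorNorm ℤ) (NumberField.discr K)) (ι : K
      →+* ℂ) (P : (W.baseChange K).toAffine.Point), W.HasCM → W.analyticRank = 1 → 5 ≤ p →
      Literature.NumberTheory.EllipticCurves.Rank1Residual.CMInert W p → ¬
      Literature.NumberTheory.EllipticCurves.Rank1Residual.Good W p →
      Literature.NumberTheory.EllipticCurves.IsImaginaryQuadratic K →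
      Literature.NumberTheory.EllipticCurves.SatisfiesHeegnerHypothesis (W.conductorNorm ℤ) K → 4 <
      (NumberField.discr K).natAbs → (∀ (L : Type) [Field L] [NumberField L], Module.finrank ℚ L = 4 → (∃ x :
      L, x ^ 2 = ((Literature.NumberTheory.EllipticCurves.Rank1Residual.cmFieldDiscrOfJ W.j : ℤ) : L)) → (∃ y :
      L, y ^ 2 = ((NumberField.discr K : ℤ) : L)) → ¬ p ∣ NumberField.classNumber L) →
      WeierstrassCurve.Affine.Point.map ι.toRatAlgHom P =
      Literature.NumberTheory.EllipticCurves.ModularForms.heegnerPointComplex Dt H → ¬ (p : ℤ) ∣ Dt.c →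
      (W.quadraticTwist (NumberField.discr K : ℚ)).entireLFunction 1 ≠ 0 → ∀ (κ :
      Literature.NumberTheory.EllipticCurves.ZpExtension K p), κ.IsAnticyclotomic → ∀ (γ :
      Field.absoluteGaloisGroup K) [Fact (κ.IsTopGenerator γ)] (𝔭 : IsDedekindDomain.HeightOneSpectrum
      (NumberField.RingOfIntegers K)) (h𝔭 : ((p : ℕ) : NumberField.RingOfIntegers K) ∈ 𝔭.asIdeal) (he :
      𝔭.asIdeal.ramificationIdx (NumberField.RingOfIntegers ℚ) = 1) (hf : 𝔭.asIdeal.inertiaDeg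
      (NumberField.RingOfIntegers ℚ) = 1), ∃ (f : CuspForm (CongruenceSubgroup.Gamma0 (W.conductorNorm ℤ)) 2),
      Literature.NumberTheory.EllipticCurves.ModularForms.IsNewformOf W f ∧ ∃ ι' : PadicAlgCl p ≃+* ℂ, (∀ (w :
      NumberField.InfinitePlace K) (k : NumberField.RingOfIntegers K), k ∈ 𝔭.asIdeal ↔ ‖ι'.symm (w.embedding (k
      : K))‖ < 1) ∧ ∃ (ΩK : ℂ) (Ωp : (Literature.NumberTheory.EllipticCurves.unrIntegers p)ˣ) (Q : PowerSeries
      (PadicComplexInt p)), ΩK ≠ 0 ∧ Summit.BirchSwinnertonDyer.Rank1Residual.X11b.R1.IsBDPLFunctionInt p ι' 𝔭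
      κ γ f ΩK ((Ωp : Literature.NumberTheory.EllipticCurves.unrIntegers p) : (PadicComplex p)) Q ∧ ∃ u :
      PadicComplex p, ‖u‖ = 1 ∧ Literature.NumberTheory.EllipticCurves.IntSeries.HasValueAt Q 0 (u *
      (algebraMap (Padic p) (PadicComplex p) (Summit.BirchSwinnertonDyer.Rank1Residual.X11b.Halves.logOmega W p
      (Summit.BirchSwinnertonDyer.Rank1Residual.X11b.embAt K p 𝔭 h𝔭 he hf) P)) ^ 2) := by
  intro W _ _ p _ _ K _ _ Dt H ι P hCM hr hp5 hin hbad hK hHN hd4 hadm hP hc hLt κ hκ γ hγ 𝔭 h𝔭 he hf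
  obtain ⟨f, hfW, ι', hι', ΩK, Ωp, L, hΩK, hL, u, hu⟩ :=
    h W p K Dt H ι P hCM hr hp5 hin hbad hK hHN hd4 hadm hP hc hLt κ hκ γ 𝔭 h𝔭 he hf
  refine ⟨f, hfW, ι', hι', ΩK, Ωp, PowerSeries.map (R1.unrToCpInt p) L, hΩK, R1.isBDPLFunctionInt_map hL,
    ((u : unrIntegers p) : ℂ_[p]), norm_coe_units_unrIntegers p u, ?_⟩
  exact (R1.intSeries_hasValueAt_map_iff p L _ _).mpr hu

/-! ### §3 The deciding theorem in ♭-currency -/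

/-- **(E♭_adm) → (W♭_adm) → (C_adm) → R₃ → R₅₇ → PUB → KS → `WAllCornerFInertBad`** — the route's rev-6 deciding
theorem `closes` VERBATIM with the two frame links read over `𝓞_{ℂ_p}⟦T⟧` and the step `key` replaced by
`two_mul_valuation_le_int`: at `p = 3` the residual R₃; at `p ≥ 5` the strong curve `W₀` and its optimal datum `D₀`
(`X12.exists_isIsogenous_optimal`), `p ∤ c(D₀)` (Edixhoven + Deuring at `p > 7`, R₅₇ at `p ∈ {5,7}`), ONE admissible
Heegner field from KS with its Heegner datum, `(κ, γ, 𝔭)` from `X11b.exists_anticyclotomic_generator_degreeOnePrime`,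
the ♭-frame and its value from (W♭), the containment from (E♭), the exponent from (C), the halves algebra, the
one-datum lemma `X12.bsdp_of_classX12_of_not_cmRamified_of_indexLowerBoundAt`, and Cassels (`Wuthrich2014.bsdp_of_isIsogenous`).
CONDITIONAL on all seven binders; nothing booked. [cite: JetchevSkinnerWan2017, §7.4.1 (arXiv:1512.06894 p. 30)]
[cite: Castella2018, Thm. 3.1 and Thm. 3.2 (arXiv:1704.06608 p. 9) (shape of the frame links)] -/
theorem wallCornerFInertBad_of_flat
    (h1 :
      ∀ (W : WeierstrassCurve ℚ) [W.IsElliptic] [W.IsGloballyMinimal] (p : ℕ) [Fact p.Prime] [NeZero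
      (W.conductorNorm ℤ)] (K : Type) [Field K] [NumberField K], W.HasCM → W.analyticRank = 1 → 5 ≤ p →
      Literature.NumberTheory.EllipticCurves.Rank1Residual.CMInert W p → ¬
      Literature.NumberTheory.EllipticCurves.Rank1Residual.Good W p →
      Literature.NumberTheory.EllipticCurves.IsImaginaryQuadratic K →
      Literature.NumberTheory.EllipticCurves.SatisfiesHeegnerHypothesis (W.conductorNorm ℤ) K → 4 <
      (NumberField.discr K).natAbs → (∀ (L : Type) [Field L] [NumberField L], Module.finrank ℚ L = 4 → (∃ x :
      L, x ^ 2 = ((Literature.NumberTheory.EllipticCurves.Rank1Residual.cmFieldDiscrOfJ W.j : ℤ) : L)) → (∃ y :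
      L, y ^ 2 = ((NumberField.discr K : ℤ) : L)) → ¬ p ∣ NumberField.classNumber L) → (W.quadraticTwist
      (NumberField.discr K : ℚ)).entireLFunction 1 ≠ 0 → ∀ (κ :
      Literature.NumberTheory.EllipticCurves.ZpExtension K p), κ.IsAnticyclotomic → ∀ (γ :
      Field.absoluteGaloisGroup K) [Fact (κ.IsTopGenerator γ)] (𝔭 : IsDedekindDomain.HeightOneSpectrum
      (NumberField.RingOfIntegers K)), ((p : ℕ) : NumberField.RingOfIntegers K) ∈ 𝔭.asIdeal →
      𝔭.asIdeal.ramificationIdx (NumberField.RingOfIntegers ℚ) = 1 → 𝔭.asIdeal.inertiaDeg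
      (NumberField.RingOfIntegers ℚ) = 1 → ∀ (f : CuspForm (CongruenceSubgroup.Gamma0 (W.conductorNorm ℤ)) 2),
      Literature.NumberTheory.EllipticCurves.ModularForms.IsNewformOf W f → ∀ (ι' : PadicAlgCl p ≃+* ℂ), (∀ (w
      : NumberField.InfinitePlace K) (k : NumberField.RingOfIntegers K), k ∈ 𝔭.asIdeal ↔ ‖ι'.symm (w.embedding
      (k : K))‖ < 1) → ∀ (ΩK : ℂ) (Ωp : (Literature.NumberTheory.EllipticCurves.unrIntegers p)ˣ) (Q :
      PowerSeries (PadicComplexInt p)), ΩK ≠ 0 →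
      Summit.BirchSwinnertonDyer.Rank1Residual.X11b.R1.IsBDPLFunctionInt p ι' 𝔭 κ γ f ΩK ((Ωp :
      Literature.NumberTheory.EllipticCurves.unrIntegers p) : (PadicComplex p)) Q →
      (Summit.BirchSwinnertonDyer.Rank1Residual.X11b.AcSelmer.XAc.charIdeal (W.baseChange K) p κ 𝔭 ∅ γ).map
      (PowerSeries.map (Summit.BirchSwinnertonDyer.Rank1Residual.X11b.R1.toCpInt p)) ≤ Ideal.span {Q})
    (h2 :
      ∀ (W : WeierstrassCurve ℚ) [W.IsElliptic] [W.IsGloballyMinimal] (p : ℕ) [Fact p.Prime] [NeZero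
      (W.conductorNorm ℤ)] (K : Type) [Field K] [NumberField K] (Dt :
      Literature.NumberTheory.EllipticCurves.ModularForms.ModularParametrizationData W (W.conductorNorm ℤ)) (H
      : Literature.NumberTheory.EllipticCurves.HeegnerDatum (W.conductorNorm ℤ) (NumberField.discr K)) (ι : K
      →+* ℂ) (P : (W.baseChange K).toAffine.Point), W.HasCM → W.analyticRank = 1 → 5 ≤ p →
      Literature.NumberTheory.EllipticCurves.Rank1Residual.CMInert W p → ¬
      Literature.NumberTheory.EllipticCurves.Rank1Residual.Good W p →
      Literature.NumberTheory.EllipticCurves.IsImaginaryQuadratic K →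
      Literature.NumberTheory.EllipticCurves.SatisfiesHeegnerHypothesis (W.conductorNorm ℤ) K → 4 <
      (NumberField.discr K).natAbs → (∀ (L : Type) [Field L] [NumberField L], Module.finrank ℚ L = 4 → (∃ x :
      L, x ^ 2 = ((Literature.NumberTheory.EllipticCurves.Rank1Residual.cmFieldDiscrOfJ W.j : ℤ) : L)) → (∃ y :
      L, y ^ 2 = ((NumberField.discr K : ℤ) : L)) → ¬ p ∣ NumberField.classNumber L) →
      WeierstrassCurve.Affine.Point.map ι.toRatAlgHom P =
      Literature.NumberTheory.EllipticCurves.ModularForms.heegnerPointComplex Dt H → ¬ (p : ℤ) ∣ Dt.c →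
      (W.quadraticTwist (NumberField.discr K : ℚ)).entireLFunction 1 ≠ 0 → ∀ (κ :
      Literature.NumberTheory.EllipticCurves.ZpExtension K p), κ.IsAnticyclotomic → ∀ (γ :
      Field.absoluteGaloisGroup K) [Fact (κ.IsTopGenerator γ)] (𝔭 : IsDedekindDomain.HeightOneSpectrum
      (NumberField.RingOfIntegers K)) (h𝔭 : ((p : ℕ) : NumberField.RingOfIntegers K) ∈ 𝔭.asIdeal) (he :
      𝔭.asIdeal.ramificationIdx (NumberField.RingOfIntegers ℚ) = 1) (hf : 𝔭.asIdeal.inertiaDeg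
      (NumberField.RingOfIntegers ℚ) = 1), ∃ (f : CuspForm (CongruenceSubgroup.Gamma0 (W.conductorNorm ℤ)) 2),
      Literature.NumberTheory.EllipticCurves.ModularForms.IsNewformOf W f ∧ ∃ ι' : PadicAlgCl p ≃+* ℂ, (∀ (w :
      NumberField.InfinitePlace K) (k : NumberField.RingOfIntegers K), k ∈ 𝔭.asIdeal ↔ ‖ι'.symm (w.embedding (k
      : K))‖ < 1) ∧ ∃ (ΩK : ℂ) (Ωp : (Literature.NumberTheory.EllipticCurves.unrIntegers p)ˣ) (Q : PowerSeries
      (PadicComplexInt p)), ΩK ≠ 0 ∧ Summit.BirchSwinnertonDyer.Rank1Residual.X11b.R1.IsBDPLFunctionInt p ι' 𝔭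
      κ γ f ΩK ((Ωp : Literature.NumberTheory.EllipticCurves.unrIntegers p) : (PadicComplex p)) Q ∧ ∃ u :
      PadicComplex p, ‖u‖ = 1 ∧ Literature.NumberTheory.EllipticCurves.IntSeries.HasValueAt Q 0 (u *
      (algebraMap (Padic p) (PadicComplex p) (Summit.BirchSwinnertonDyer.Rank1Residual.X11b.Halves.logOmega W p
      (Summit.BirchSwinnertonDyer.Rank1Residual.X11b.embAt K p 𝔭 h𝔭 he hf) P)) ^ 2))
    (h3 : ControlCMInertBadAdm) (h4 : InertBadAtThree) (h5 : ManinDatumFiveSevenCMInert)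
    (h6 : PublishedInputsBiquadratic) (h7 : HeegnerFieldSupplyCMInertBadAdm) :
    Summit.BirchSwinnertonDyer.WAllCornerFInertBad := by
  obtain ⟨hGZ, hKo, hMN, hGZK, hmod, hnf, hFH, hCM8, hEdx, hDeu, hCassels⟩ := h6
  intro W _ _ p _ hCM hr hp2 hin hbad
  have hp : p.Prime := Fact.out
  by_cases hp3 : p = 3
  · subst hp3
    exact Literature.NumberTheory.EllipticCurves.Rank1Residual.Typed.bsdp_of_missingPPartAt W 3 hGZK
      hr.le (h4 W hCM hr hin hbad (fun h ↦ hin.2 h.2))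
  have hp5 : 5 ≤ p := hp.five_le_of_ne_two_of_ne_three hp2 hp3
  -- (2) the strong curve of the isogeny class and its optimal datum
  obtain ⟨W₀, _, _, _, D₀, hiso, hN0, hopt⟩ := X12.exists_isIsogenous_optimal hnf W
  have hCM0 : W₀.HasCM := (X12.hasCM_iff_of_isIsogenous hiso).mp hCM
  have hin0 : CMInert W₀ p := (X12.cmInert_iff_of_isIsogenous hiso hCM p).mp hin
  have hX : ClassX12 W p := ⟨hCM, hr, Or.inr (Or.inr (Or.inr hbad))⟩
  have hX0 : ClassX12 W₀ p := (X12.classX12_iff_of_isIsogenous hiso p).mp hX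
  have hr0 : W₀.analyticRank = 1 := hX0.2.1
  have hpN : p ∣ W.conductorNorm ℤ := (W.dvd_conductorNorm_iff_not_hasGoodReductionAtPrime p).mpr hbad
  have hpN0 : p ∣ W₀.conductorNorm ℤ := hN0 ▸ hpN
  have hbad0 : ¬ Good W₀ p := (W₀.dvd_conductorNorm_iff_not_hasGoodReductionAtPrime p).mp hpN0
  -- (3) the Manin datum: Edixhoven + Deuring at `p > 7`, the residual item at `p ∈ {5, 7}`
  have hc0 : ¬ (p : ℤ) ∣ D₀.c := by
    by_cases hp7 : 7 < p
    · exact X12.not_dvd_maninConstant_of_hasCM_of_not_cmSplit_of_optimal hEdx hDeu W₀ p hCM0 hp7 hin0.2 D₀ hopt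
    · have h6 : p ≠ 6 := by rintro rfl; exact absurd hp (by decide)
      exact h5 W₀ p D₀ hCM0 hr0 (by omega) hin0 hbad0 hopt
  -- (4) BSD_p for the strong curve: STEP L at one admissible Heegner datum from the three links
  have hb0 : BSDp W₀ p := by
    obtain ⟨K, _, _, hK, hd4, hHN, hLt, hadm⟩ := h7 W₀ p hCM0 hr0 hp5 hin0 hbad0
    obtain ⟨β, hβ⟩ := exists_dvd_sq_sub_discr_holds (W₀.conductorNorm ℤ) K hK hHN
    obtain ⟨H, -⟩ := nonempty_heegnerDatum_holds (W₀.conductorNorm ℤ) K hK hβ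
    obtain ⟨ι⟩ : Nonempty (K →+* ℂ) := inferInstance
    obtain ⟨P, hP⟩ := heegnerPointComplex_mem_range_map_holds (W₀.conductorNorm ℤ) W₀ K hK hHN D₀ H ι
    have hμ : ¬ p ∣ NumberField.Units.torsionOrder K :=
      X12.not_dvd_torsionOrder_of_four_lt_natAbs_discr p (by omega) K hK hd4
    refine X12.bsdp_of_classX12_of_not_cmRamified_of_indexLowerBoundAt hGZ hKo hMN hGZK hmod hnf hFH hCM8 W₀ p
      K D₀ H ι P hX0 hp5 hin0.1 hK hHN hP hc0 hμ hLt ?_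
    intro hfin
    obtain ⟨κ, γ, 𝔭, hκ, hγ, h𝔭, he, hf⟩ :=
      exists_anticyclotomic_generator_degreeOnePrime p K hK (hHN.of_dvd hpN0)
    haveI : Fact (κ.IsTopGenerator γ) := ⟨hγ⟩
    obtain ⟨f, hfW, ι', hι', ΩK, Ωp, Q, hΩK, hQ, u, hu1, hu⟩ :=
      h2 W₀ p K D₀ H ι P hCM0 hr0 hp5 hin0 hbad0 hK hHN hd4 hadm hP hc0 hLt κ hκ γ 𝔭 h𝔭 he hf
    have hdiv := h1 W₀ p K hCM0 hr0 hp5 hin0 hbad0 hK hHN hd4 hadm hLt κ hκ γ 𝔭 h𝔭 he hf f hfW ι' hι'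
      ΩK Ωp Q hΩK hQ
    obtain ⟨n, ⟨htors, g, hg, hg0, hgn⟩, hctl⟩ :=
      h3 W₀ p K D₀ H ι P hCM0 hr0 hp5 hin0 hbad0 hK hHN hd4 hadm hP hc0 hLt κ hκ γ 𝔭 h𝔭 he hf
    have hmem : PowerSeries.map (R1.toCpInt p) g ∈ Ideal.span {Q} := by
      rw [hg, map_span_singleton_powerSeries] at hdiv
      exact (Ideal.span_singleton_le_iff_mem _).mp hdiv
    obtain ⟨hx0, hle⟩ := two_mul_valuation_le_int hg0 hmem hu1.le hu
    rw [valuation_logOmega hx0, hgn] at hle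
    haveI := hfin
    haveI : Finite (AddCommGroup.primaryComponent (W₀.baseChange K).sha p) :=
      Finite.of_injective _ Subtype.val_injective
    have h : 2 * (padicValNat p (AddSubgroup.zmultiples P).index : ℤ) ≤
        (padicValNat p (Nat.card (AddCommGroup.primaryComponent (W₀.baseChange K).sha p)) : ℤ) +
          padicValNat p (tamagawaProductSplit W₀ K) := by
      push_cast at hle hctl ⊢
      omega
    rw [padicValNat_tamagawaProductSplit_eq_of_heegner W₀ p K hp5 hK rfl hHN,
      padicValNat_tamagawaProduct_baseChange_of_heegner W₀ p hp5 K hK rfl hHN,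
      padicValNat_card_addPrimaryComponent] at h
    unfold IndexLowerBoundAt
    rw [WeierstrassCurve.shaOrder]
    omega
  -- (5) Cassels: every curve of the class
  exact Wuthrich2014.bsdp_of_isIsogenous hCassels hiso (hGZK W₀ (by rw [hr0])).2
    (W₀.leadingLCoeff_ne_zero_holds (hmod W₀)) hb0

end Summit.BirchSwinnertonDyer.BirchSwinnertonDyer.Theorems.BiquadraticEisensteinDescentKatzWaldspurgerFrameCMInertBadFlatGlue

end
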